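import Literature.NumberTheory.ConnesConsani2021.SeriesRemainderBounds
import Literature.NumberTheory.ConnesConsani2021.ProlateProjections
import HarnessLib

/-!
# Connes–Consani 2021, App. F (Lemma F.1) for THE prolate vectors of §4: the glue
# `IsAppEProlateDatum n (prolateFun n) (prolateEigen n) χ_n` from the §4 named facts

RH-FREE corpus literature (label, line 1): bookkeeping between two statement files of the cell, no
statement about `ζ`, Weil positivity or RH; nothing here bears on the truth of RH.  bears_on: W-C/W-P,
apex input (B) / route binder K0 (`DensityRegular`).

`SeriesRemainderBounds.lean` proves Lemma F.1 (= arXiv Lemma 49) of A. Connes, C. Consani, *Weil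
positivity and trace formula, the archimedean place*, Selecta Math. 27 (2021) 77 = arXiv:2006.13771
[bib `ConnesConsani2021`], App. F, for every datum `IsAppEProlateDatum n ψ lam χ` (the §4 prolate datum
with the prolate-literature inequalities App. F imports, as hypotheses).  `ProlateProjections.lean`
(§4, first part) fixes THE objects: `prolateFun n = h_{2n,1}` (`= ±ξ_n/√2`), `prolateEigen n = λ(n)`, and
types the §4 inputs as named facts: (cosalphan)/(prolateeq) `CC2021_sec4_cosalphan`, `|λ(n)| < 1`
(`CC2021_sec4_lambda_basic`), (rapid-decay) `CC2021_sec4_rapidDecay` (with `rokhlinXiaoBound`).  This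
file assembles the datum for `(prolateFun n, prolateEigen n, χ_n)` from those facts, [Rokhlin–Xiao 2007,
Thm 12] in tree normalisation (taken as an explicit hypothesis `hRX12` until the §5 file's named fact
lands — then one line), and the two [Wang 2010] facts of `SeriesRemainderBounds.lean`; whence Lemma F.1
for the actual terms `τ(n)T_n(ρ)` of the series (qe)/(sonineQ) of Prop. 5.3 and (computersafe),
(computersafe1) for them, FACT-FREE except for exactly those cited inputs.  No new definition, no new
named fact.
-/

noncomputable section

open Real MeasureTheory Set Filter intervalIntegral Complex
open scoped Nat Topology Interval

namespace Literature.NumberTheory.ConnesConsani2021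

open Literature.NumberTheory.LFunctions

/-- RH-FREE. The real cosine transform is the real part of the finite Fourier integral with kernel
`e^{2πixω}` used in (prolateeq)/(cosalphan). [cite: ConnesConsani2021, §4 eq. (prolateeq) (arXiv chunk p0016:L17–L28)] -/
theorem cosTransform_eq_re_fourier {ψ : ℝ → ℝ} (hψ : ContinuousOn ψ (Icc (-1) 1)) (ω : ℝ) :
    cosTransform ψ ω = (∫ x in (-1 : ℝ)..1, (ψ x : ℂ) * cexp (2 * π * I * x * ω)).re := by
  have hI : uIcc (-1 : ℝ) 1 = Icc (-1) 1 := uIcc_of_le (by norm_num)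
  have hint : IntervalIntegrable (fun x : ℝ ↦ (ψ x : ℂ) * cexp (2 * π * I * x * ω)) volume (-1) 1 := by
    apply ContinuousOn.intervalIntegrable; rw [hI]
    exact (continuous_ofReal.comp_continuousOn hψ).mul (by fun_prop)
  have key : ∀ x : ℝ, ((ψ x : ℂ) * cexp (2 * π * I * x * ω)).re = ψ x * Real.cos (2 * π * x * ω) := by
    intro x
    have e : (2 * π * I * x * ω : ℂ) = ((2 * π * x * ω : ℝ) : ℂ) * I := by push_cast; ring
    rw [e, Complex.exp_mul_I, re_ofReal_mul, Complex.add_re, Complex.cos_ofReal_re, Complex.mul_re,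
      Complex.I_re, Complex.I_im, Complex.sin_ofReal_im]
    ring
  have h := intervalIntegral_re hint
  simp only [RCLike.re_to_complex] at h
  rw [← h, cosTransform]
  exact integral_congr fun x _ ↦ (key x).symm

/-- RH-FREE. **The App. F datum of THE prolate vectors.**  From the §4 named facts of
`ProlateProjections.lean` ((cosalphan) `CC2021_sec4_cosalphan`, `|λ(n)| < 1` from
`CC2021_sec4_lambda_basic`, (rapid-decay) `CC2021_sec4_rapidDecay`), [Rokhlin–Xiao 2007, Thm 12] in tree
normalisation (`hRX12`, the §5 file's input) and the [Wang 2010] facts `Wang2010_lemma_2_2`,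
`Wang2010_thm_3_6`: `(prolateFun n, prolateEigen n, χ_{2n}^{2π})` is an `IsAppEProlateDatum`.
[cite: ConnesConsani2021, Prop. 4.5 (i) §4 (arXiv item 25, chunk p0016:L50); App. F (arXiv chunk p0035:L7–L75)] -/
theorem exists_isAppEProlateDatum_prolateFun (hcos : CC2021_sec4_cosalphan)
    (hbasic : CC2021_sec4_lambda_basic) (hrapid : CC2021_sec4_rapidDecay)
    (hRX12 : ∀ n : ℕ, |prolateFun n 1| < Real.sqrt (2 * n + 1 / 2))
    (hW2 : Wang2010_lemma_2_2) (hW3 : Wang2010_thm_3_6) (n : ℕ) :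
    ∃ χ : ℝ, IsAppEProlateDatum n (prolateFun n) (prolateEigen n) χ := by
  have hψ := isProlateFunction_prolateFun n
  obtain ⟨χ, hχ⟩ := hψ.eigen
  refine ⟨χ, ?_⟩
  have hψc : ContinuousOn (prolateFun n) (Icc (-1) 1) := by
    simpa using hψ.contDiffOn.continuousOn
  obtain ⟨hW2', hW3'⟩ := IsAppEProlateDatum.wang_inputs_of hW2 hW3 hψ hχ
  exact
    { isProlate := hψ
      eigen := hχ
      cosTransform_eq := fun x hx ↦ by
        rw [cosTransform_eq_re_fourier hψc, hcos n x hx, re_ofReal_mul, Complex.ofReal_re]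
      sq_lam_lt := by
        have h1 := hbasic.2.1 n
        have h0 := abs_nonneg (prolateEigen n)
        nlinarith [sq_abs (prolateEigen n)]
      abs_lam_le := by
        have h := hrapid.1 n
        rw [rokhlinXiaoBound] at h
        convert h using 1
        ring
      abs_apply_one_lt := hRX12 n
      eigen_gt := hW2'.1
      eigen_lt := hW2'.2
      wang := hW3' }

/-- RH-FREE. **Lemma F.1 termwise for THE series (qe)/(sonineQ) of Prop. 5.3**: for `n ≥ 3` and
`ρ ∈ [1,2]`, `|τ(n)T_n(ρ)| = |sonineQTerm (prolateFun n) (prolateEigen n) ρ| ≤ a(n)`, conditional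
exactly on the cited §4/prolate inputs. [cite: ConnesConsani2021, App. F Lemma F.1 (i) (arXiv Lemma 49), arXiv PDF p. 55 (chunk p0035:L87–L92)] -/
theorem sonineQTerm_prolateFun_le (hcos : CC2021_sec4_cosalphan)
    (hbasic : CC2021_sec4_lambda_basic) (hrapid : CC2021_sec4_rapidDecay)
    (hRX12 : ∀ n : ℕ, |prolateFun n 1| < Real.sqrt (2 * n + 1 / 2))
    (hW2 : Wang2010_lemma_2_2) (hW3 : Wang2010_thm_3_6) {n : ℕ} (hn : 3 ≤ n) {ρ : ℝ}
    (hρ : ρ ∈ Icc (1 : ℝ) 2) :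
    |sonineQTerm (prolateFun n) (prolateEigen n) ρ| ≤ remainderTerm n := by
  obtain ⟨χ, d⟩ := exists_isAppEProlateDatum_prolateFun hcos hbasic hrapid hRX12 hW2 hW3 n
  exact CC2021_lemma_49_termwise_holds n _ _ χ hn d ρ hρ

/-- RH-FREE. **Lemma F.1 (i) = (computersafe) for THE series** (`N ≥ 2`): absolute convergence of
`Σ_{n>N} τ(n)T_n(ρ)` and `|Σ_{n>N} τ(n)T_n(ρ)| ≤ Σ_{n>N} a(n)` for `ρ ∈ [1,2]`, conditional exactly on
the cited §4/prolate inputs. [cite: ConnesConsani2021, App. F Lemma F.1 (i) (arXiv Lemma 49) eq. (computersafe), arXiv PDF p. 55 (chunk p0035:L78–L81)] -/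
theorem lemma_49_i_prolateFun (hcos : CC2021_sec4_cosalphan)
    (hbasic : CC2021_sec4_lambda_basic) (hrapid : CC2021_sec4_rapidDecay)
    (hRX12 : ∀ n : ℕ, |prolateFun n 1| < Real.sqrt (2 * n + 1 / 2))
    (hW2 : Wang2010_lemma_2_2) (hW3 : Wang2010_thm_3_6) {N : ℕ} (hN : 2 ≤ N) {ρ : ℝ}
    (hρ : ρ ∈ Icc (1 : ℝ) 2) :
    Summable (fun k : ℕ ↦ sonineQTerm (prolateFun (k + (N + 1))) (prolateEigen (k + (N + 1))) ρ) ∧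
      |∑' k : ℕ, sonineQTerm (prolateFun (k + (N + 1))) (prolateEigen (k + (N + 1))) ρ|
        ≤ ∑' k : ℕ, remainderTerm (k + (N + 1)) := by
  choose χ hχ using exists_isAppEProlateDatum_prolateFun hcos hbasic hrapid hRX12 hW2 hW3
  exact CC2021_lemma_49_i_holds hN (fun n _ ↦ hχ n) hρ

/-- RH-FREE. **Lemma F.1 (ii) = (computersafe1) for THE series**: `|Σ_{n≥11} τ(n)T_n(ρ)| ≤ 2.366·10^{-12}`
for `ρ ∈ [1,2]` (the number certified in `SeriesRemainderBounds.lean`), conditional exactly on the cited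
§4/prolate inputs. [cite: ConnesConsani2021, App. F Lemma F.1 (ii) (arXiv Lemma 49) eq. (computersafe1), arXiv PDF p. 55 (chunk p0035:L82–L85)] -/
theorem lemma_49_ii_prolateFun (hcos : CC2021_sec4_cosalphan)
    (hbasic : CC2021_sec4_lambda_basic) (hrapid : CC2021_sec4_rapidDecay)
    (hRX12 : ∀ n : ℕ, |prolateFun n 1| < Real.sqrt (2 * n + 1 / 2))
    (hW2 : Wang2010_lemma_2_2) (hW3 : Wang2010_thm_3_6) {ρ : ℝ} (hρ : ρ ∈ Icc (1 : ℝ) 2) :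
    Summable (fun k : ℕ ↦ sonineQTerm (prolateFun (k + 11)) (prolateEigen (k + 11)) ρ) ∧
      |∑' k : ℕ, sonineQTerm (prolateFun (k + 11)) (prolateEigen (k + 11)) ρ| ≤ (2.366e-12 : ℝ) := by
  choose χ hχ using exists_isAppEProlateDatum_prolateFun hcos hbasic hrapid hRX12 hW2 hW3
  exact CC2021_lemma_49_ii_holds (fun n _ ↦ hχ n) hρ


/-! ## The same corollaries with the [Wang 2010] inputs discharged

After `Wang2010_lemma_2_2_holds` and `Wang2010_thm_3_6_holds` (`SeriesRemainderBounds.lean`), the App. F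
datum and Lemma F.1 for THE prolate sequence depend only on the §4 named facts of
`ProlateProjections.lean` ((cosalphan), `|λ(n)| < 1`, (rapid-decay)) and the [Rokhlin–Xiao 2007, Thm 12]
binder `hRX12`. -/

/-- RH-FREE. The App. F datum of THE prolate vectors from the §4 facts and [RX07 Thm 12] alone (the
[Wang 2010] inputs are theorems). [cite: ConnesConsani2021, Prop. 4.5 (i) §4 (arXiv item 25, chunk p0016:L50); App. F (arXiv chunk p0035:L7–L75)] -/
theorem exists_isAppEProlateDatum_prolateFun' (hcos : CC2021_sec4_cosalphan)
    (hbasic : CC2021_sec4_lambda_basic) (hrapid : CC2021_sec4_rapidDecay)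
    (hRX12 : ∀ n : ℕ, |prolateFun n 1| < Real.sqrt (2 * n + 1 / 2)) (n : ℕ) :
    ∃ χ : ℝ, IsAppEProlateDatum n (prolateFun n) (prolateEigen n) χ :=
  exists_isAppEProlateDatum_prolateFun hcos hbasic hrapid hRX12 Wang2010_lemma_2_2_holds
    Wang2010_thm_3_6_holds n

/-- RH-FREE. **Lemma F.1 termwise for THE series**, [Wang] inputs discharged: for `n ≥ 3`, `ρ ∈ [1,2]`,
`|τ(n)T_n(ρ)| ≤ a(n)`. [cite: ConnesConsani2021, App. F Lemma F.1 (i) (arXiv Lemma 49), arXiv PDF p. 55 (chunk p0035:L87–L92)] -/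
theorem sonineQTerm_prolateFun_le' (hcos : CC2021_sec4_cosalphan)
    (hbasic : CC2021_sec4_lambda_basic) (hrapid : CC2021_sec4_rapidDecay)
    (hRX12 : ∀ n : ℕ, |prolateFun n 1| < Real.sqrt (2 * n + 1 / 2)) {n : ℕ} (hn : 3 ≤ n) {ρ : ℝ}
    (hρ : ρ ∈ Icc (1 : ℝ) 2) :
    |sonineQTerm (prolateFun n) (prolateEigen n) ρ| ≤ remainderTerm n :=
  sonineQTerm_prolateFun_le hcos hbasic hrapid hRX12 Wang2010_lemma_2_2_holds Wang2010_thm_3_6_holds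
    hn hρ

/-- RH-FREE. **Lemma F.1 (i) = (computersafe) for THE series** (`N ≥ 2`), [Wang] inputs discharged.
[cite: ConnesConsani2021, App. F Lemma F.1 (i) (arXiv Lemma 49) eq. (computersafe), arXiv PDF p. 55 (chunk p0035:L78–L81)] -/
theorem lemma_49_i_prolateFun' (hcos : CC2021_sec4_cosalphan)
    (hbasic : CC2021_sec4_lambda_basic) (hrapid : CC2021_sec4_rapidDecay)
    (hRX12 : ∀ n : ℕ, |prolateFun n 1| < Real.sqrt (2 * n + 1 / 2)) {N : ℕ} (hN : 2 ≤ N) {ρ : ℝ}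
    (hρ : ρ ∈ Icc (1 : ℝ) 2) :
    Summable (fun k : ℕ ↦ sonineQTerm (prolateFun (k + (N + 1))) (prolateEigen (k + (N + 1))) ρ) ∧
      |∑' k : ℕ, sonineQTerm (prolateFun (k + (N + 1))) (prolateEigen (k + (N + 1))) ρ|
        ≤ ∑' k : ℕ, remainderTerm (k + (N + 1)) :=
  lemma_49_i_prolateFun hcos hbasic hrapid hRX12 Wang2010_lemma_2_2_holds Wang2010_thm_3_6_holds hN hρ

/-- RH-FREE. **Lemma F.1 (ii) = (computersafe1) for THE series**, [Wang] inputs discharged: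
`|Σ_{n≥11} τ(n)T_n(ρ)| ≤ 2.366·10^{-12}` for `ρ ∈ [1,2]`.
[cite: ConnesConsani2021, App. F Lemma F.1 (ii) (arXiv Lemma 49) eq. (computersafe1), arXiv PDF p. 55 (chunk p0035:L82–L85)] -/
theorem lemma_49_ii_prolateFun' (hcos : CC2021_sec4_cosalphan)
    (hbasic : CC2021_sec4_lambda_basic) (hrapid : CC2021_sec4_rapidDecay)
    (hRX12 : ∀ n : ℕ, |prolateFun n 1| < Real.sqrt (2 * n + 1 / 2)) {ρ : ℝ} (hρ : ρ ∈ Icc (1 : ℝ) 2) :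
    Summable (fun k : ℕ ↦ sonineQTerm (prolateFun (k + 11)) (prolateEigen (k + 11)) ρ) ∧
      |∑' k : ℕ, sonineQTerm (prolateFun (k + 11)) (prolateEigen (k + 11)) ρ| ≤ (2.366e-12 : ℝ) :=
  lemma_49_ii_prolateFun hcos hbasic hrapid hRX12 Wang2010_lemma_2_2_holds Wang2010_thm_3_6_holds hρ

end Literature.NumberTheory.ConnesConsani2021
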